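import Mathlib
import Summits.Ventures.PercRepro2.LocRows
import Summits.Ventures.PercRepro2.SwRow
import Summits.Ventures.PercRepro2.SwOut
import Summits.Ventures.PercRepro2.SwAllRow
import Summits.Ventures.PercRepro2.SwOutAll
import Summits.Ventures.PercRepro2.SwOutArmFlip
import Summits.Ventures.PercRepro2.SwOutArmThm
import Summits.Ventures.PercRepro2.SwOutCoreDefs

/-!
# The shadow cube: vocabulary and the hull formula (blind cell PercRepro2, night-4 g13,
2026-08-26; proofs/NIGHT4-G12.md §2 (2.2), §3 (L4), proofs/NIGHT4-G13.md §3)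

The SHADOW CUBE of a one-sided point of a core cube with dropped pure arms pairs the two
escaping states of the junction: it is the orbit of a core-free configuration under the flips of
its arms `B j` (the coarse arm `X` of `u` and the far arms), where ONE arm `B k₀` carries a
DECORATION `Z` — the dropped pure arms, outside the hull, attached to `B k₀` by blue edges — that
flips together with it.  `ShadowBase` records such a base `σ` with every arm red; `shadowReal σ ω`
flips the arms assigned `false` (with `Z` when `B k₀` is flipped).  The hull formula
(`cluster_shadowReal`): the red cluster of `h` is `h` with the red arms — `Z` never enters the
hull, which is why the cube principle applies (`SwOutShadowCube`).
-/

namespace Summit.Ventures.PercRepro2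

namespace LocRows

open Hull

variable {V : Type*} {E : Type*}

open scoped Classical

variable {ends : E → Sym2 V}

/-- **The data of a shadow cube**: a base configuration `σ` (every arm red), arms `B j` (pairwise
disjoint, no edges between them, each red-connected to `h` inside itself, `h` sees only arms by red
edges), and a decoration `Z` (disjoint from the arms and from `h`, no edge to `h` or to an arm other
than `B k₀`, joined to `B k₀` by blue edges only); every edge leaving `{h} ∪ arms ∪ Z` is blue. -/
structure ShadowBase (ends : E → Sym2 V) (σ : Config E) (h : V) (Z : Set V) {κ : Type*}
    (B : κ → Set V) (k₀ : κ) : Prop where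
  h_notMem_B : ∀ j, h ∉ B j
  h_notMem_Z : h ∉ Z
  B_disj : ∀ j j', j ≠ j' → ∀ x, x ∈ B j → x ∉ B j'
  B_disj_Z : ∀ j x, x ∈ B j → x ∉ Z
  B_nonempty : ∀ j, (B j).Nonempty
  bdry_blue : ∀ e x y, ends e = s(x, y) → x ∈ {h} ∪ {x | ∃ j, x ∈ B j} ∪ Z →
    y ∉ {h} ∪ {x | ∃ j, x ∈ B j} ∪ Z → σ e = false
  no_cross : ∀ j j', j ≠ j' → ∀ e x y, ends e = s(x, y) → x ∈ B j → y ∈ B j' → False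
  no_BZ : ∀ j, j ≠ k₀ → ∀ e x y, ends e = s(x, y) → x ∈ B j → y ∈ Z → False
  no_hZ : ∀ e y, ends e = s(h, y) → y ∉ Z
  kZ_blue : ∀ e x y, ends e = s(x, y) → x ∈ B k₀ → y ∈ Z → σ e = false
  h_edges : ∀ e x, ends e = s(h, x) → ∃ j, x ∈ B j
  h_red : ∀ e x, ends e = s(h, x) → σ e = true
  B_conn : ∀ j, ∀ x ∈ B j, x ∈ cluster ends (insideConfig ends (B j ∪ {h}) σ) h

section Defs

variable {κ : Type*} (B : κ → Set V) (Z : Set V) (k₀ : κ)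

/-- The vertices flipped by a cube point: the arms assigned `false`, with the decoration when
`B k₀` is assigned `false`. -/
def shadowFalse (ω : Config κ) : Set V :=
  {x | ∃ j, ω j = false ∧ x ∈ B j} ∪ {x | ω k₀ = false ∧ x ∈ Z}

/-- The arms with the decoration. -/
def shadowAll : Set V := {x | ∃ j, x ∈ B j} ∪ Z

variable (ends) in
/-- The realisation of a cube point of the shadow cube. -/
noncomputable def shadowReal (σ : Config E) (ω : Config κ) : Config E :=
  flip ends (shadowFalse B Z k₀ ω) σ

variable (h : V) in
/-- The red cluster of `h` of a cube point: `h` with the red arms. -/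
def sRed (ω : Config κ) : Set V := {h} ∪ {x | ∃ j, ω j = true ∧ x ∈ B j}

variable (h : V) in
/-- The red envelope: `h`, the red arms, and the decoration when `B k₀` is red. -/
def sAll (ω : Config κ) : Set V := {h} ∪ {x | ∃ j, ω j = true ∧ x ∈ B j} ∪ {x | ω k₀ = true ∧ x ∈ Z}

variable {B Z k₀}

/-- Membership in `sRed`. -/
lemma mem_sRed_iff {h : V} {ω : Config κ} {x : V} :
    x ∈ sRed B h ω ↔ x = h ∨ ∃ j, ω j = true ∧ x ∈ B j := by
  simp only [sRed, Set.mem_union, Set.mem_singleton_iff, Set.mem_setOf_eq]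

/-- Membership in `sAll`. -/
lemma mem_sAll_iff {h : V} {ω : Config κ} {x : V} :
    x ∈ sAll B Z k₀ h ω ↔ x = h ∨ (∃ j, ω j = true ∧ x ∈ B j) ∨ (ω k₀ = true ∧ x ∈ Z) := by
  simp only [sAll, Set.mem_union, Set.mem_singleton_iff, Set.mem_setOf_eq, or_assoc]

/-- `shadowFalse (flipAll ω)` and `shadowFalse ω` partition the arms and the decoration. -/
lemma shadowFalse_subset_shadowAll (ω : Config κ) : shadowFalse B Z k₀ ω ⊆ shadowAll B Z := by
  rintro x (⟨j, _, hx⟩ | ⟨_, hx⟩)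
  · exact Or.inl ⟨j, hx⟩
  · exact Or.inr hx

end Defs

section Base

variable {κ : Type*} {B : κ → Set V} {Z : Set V} {k₀ : κ} {σ : Config E} {h : V}
  (hb : ShadowBase ends σ h Z B k₀)
include hb

/-- No loop at `h`. -/
lemma ShadowBase.loop_h (e : E) : ends e ≠ s(h, h) := by
  intro he
  obtain ⟨j, hj⟩ := hb.h_edges e h he
  exact hb.h_notMem_B j hj

/-- The two ends of an edge in arms lie in the same arm. -/
lemma ShadowBase.arm_eq_of_edge {j j' : κ} {e : E} {x y : V} (hxy : ends e = s(x, y))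
    (hx : x ∈ B j) (hy : y ∈ B j') : j = j' := by
  by_contra hne
  exact hb.no_cross j j' hne e x y hxy hx hy

/-- An edge with an end in `B j` is flipped by `ω` iff `ω j = false`. -/
lemma ShadowBase.touches_shadowFalse_iff_of_mem {ω : Config κ} {j : κ} {e : E} {x y : V}
    (hxy : ends e = s(x, y)) (hx : x ∈ B j) :
    e ∈ touches ends (shadowFalse B Z k₀ ω) ↔ ω j = false := by
  constructor
  · rintro ⟨z, hz, w, hzw⟩
    rw [hxy, Sym2.eq_iff] at hzw
    rcases hz with ⟨j', hj', hzj'⟩ | ⟨hk, hzZ⟩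
    · rcases hzw with ⟨h1, _⟩ | ⟨_, h2⟩
      · rw [h1] at hx
        have : j' = j := by
          by_contra hne
          exact hb.B_disj j' j hne z hzj' hx
        rw [← this]; exact hj'
      · rw [← h2] at hzj'
        have := hb.arm_eq_of_edge hxy hx hzj'
        rw [this]; exact hj'
    · rcases hzw with ⟨h1, _⟩ | ⟨_, h2⟩
      · rw [h1] at hx
        exact absurd hzZ (hb.B_disj_Z j z hx)
      · rw [← h2] at hzZ
        have hjk : j = k₀ := by
          by_contra hne
          exact hb.no_BZ j hne e x y hxy hx hzZ
        rw [hjk]; exact hk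
  · intro hj
    exact ⟨x, Or.inl ⟨j, hj, hx⟩, y, hxy⟩

/-- An edge with an end in `Z` and no end in an arm is flipped by `ω` iff `ω k₀ = false`. -/
lemma ShadowBase.touches_shadowFalse_iff_of_mem_Z {ω : Config κ} {e : E} {x y : V}
    (hxy : ends e = s(x, y)) (hx : x ∈ Z) (hyB : ∀ j, y ∉ B j) :
    e ∈ touches ends (shadowFalse B Z k₀ ω) ↔ ω k₀ = false := by
  constructor
  · rintro ⟨z, hz, w, hzw⟩
    rw [hxy, Sym2.eq_iff] at hzw
    rcases hz with ⟨j, _, hzj⟩ | ⟨hk, _⟩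
    · exfalso
      rcases hzw with ⟨h1, _⟩ | ⟨_, h2⟩
      · rw [h1] at hx; exact hb.B_disj_Z j z hzj hx
      · rw [← h2] at hzj; exact hyB j hzj
    · exact hk
  · intro hk
    exact ⟨x, Or.inr ⟨hk, hx⟩, y, hxy⟩

/-- The value of a realisation on an edge with an end in `B j`. -/
lemma ShadowBase.shadowReal_apply_of_mem {ω : Config κ} {j : κ} {e : E} {x y : V}
    (hxy : ends e = s(x, y)) (hx : x ∈ B j) :
    shadowReal ends B Z k₀ σ ω e = (if ω j = true then σ e else !σ e) := by
  unfold shadowReal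
  by_cases hj : ω j = true
  · rw [flip_apply_of_notMem, if_pos hj]
    rw [hb.touches_shadowFalse_iff_of_mem hxy hx, hj]; decide
  · rw [flip_apply_of_mem, if_neg hj]
    rw [hb.touches_shadowFalse_iff_of_mem hxy hx]
    simpa using hj

/-- The value of a realisation on an edge with an end in `Z` and no end in an arm. -/
lemma ShadowBase.shadowReal_apply_of_mem_Z {ω : Config κ} {e : E} {x y : V}
    (hxy : ends e = s(x, y)) (hx : x ∈ Z) (hyB : ∀ j, y ∉ B j) :
    shadowReal ends B Z k₀ σ ω e = (if ω k₀ = true then σ e else !σ e) := by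
  unfold shadowReal
  by_cases hk : ω k₀ = true
  · rw [flip_apply_of_notMem, if_pos hk]
    rw [hb.touches_shadowFalse_iff_of_mem_Z hxy hx hyB, hk]; decide
  · rw [flip_apply_of_mem, if_neg hk]
    rw [hb.touches_shadowFalse_iff_of_mem_Z hxy hx hyB]
    simpa using hk

omit hb in
/-- The value of a realisation on an edge touching neither the arms nor the decoration. -/
lemma ShadowBase.shadowReal_apply_of_notMem {ω : Config κ} {e : E}
    (he : e ∉ touches ends (shadowAll B Z)) : shadowReal ends B Z k₀ σ ω e = σ e := by
  unfold shadowReal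
  rw [flip_apply_of_notMem]
  exact fun h' => he (touches_mono (shadowFalse_subset_shadowAll ω) h')

/-- An edge inside `B j ∪ {h}` keeps its base colour when `B j` is red. -/
lemma ShadowBase.shadowReal_apply_of_within {ω : Config κ} {j : κ} (hj : ω j = true) {e : E}
    (he : e ∈ within ends (B j ∪ {h})) : shadowReal ends B Z k₀ σ ω e = σ e := by
  obtain ⟨x, hx, y, hy, hxy⟩ := he
  rcases hx with hx | hx
  · rw [hb.shadowReal_apply_of_mem hxy hx, if_pos hj]
  · rcases hy with hy | hy
    · rw [hb.shadowReal_apply_of_mem (ends_swap hxy) hy, if_pos hj]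
    · exfalso
      rw [Set.mem_singleton_iff] at hx hy
      subst hx; subst hy
      exact hb.loop_h e hxy

/-- The red edges inside `B j ∪ {h}` of the base are red in every realisation with `B j` red. -/
lemma ShadowBase.insideConfig_le_shadowReal {ω : Config κ} {j : κ} (hj : ω j = true) :
    insideConfig ends (B j ∪ {h}) σ ≤ shadowReal ends B Z k₀ σ ω := by
  intro e
  by_cases he : insideConfig ends (B j ∪ {h}) σ e = true
  · rw [he]
    obtain ⟨hσe, hw⟩ := insideConfig_eq_true_iff.1 he
    rw [hb.shadowReal_apply_of_within hj hw, hσe]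
  · simp only [Bool.not_eq_true] at he
    rw [he]
    exact Bool.false_le _

/-- **The realisation is injective.** -/
theorem ShadowBase.shadowReal_injective : Function.Injective (shadowReal ends B Z k₀ σ) := by
  intro ω ω' heq
  funext j
  obtain ⟨x, hx⟩ := hb.B_nonempty j
  obtain ⟨e, hxe⟩ := exists_edge_of_mem_cluster (h := h) (hb.B_conn j x hx) (fun h' =>
    hb.h_notMem_B j (h' ▸ hx))
  have hxy : ends e = s(x, Sym2.Mem.other hxe) := (Sym2.other_spec hxe).symm
  have h1 := hb.shadowReal_apply_of_mem (ω := ω) hxy hx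
  have h2 := hb.shadowReal_apply_of_mem (ω := ω') hxy hx
  rw [heq] at h1
  rw [h1] at h2
  by_contra hne
  have key : ∀ b b' : Bool, b ≠ b' →
      (if b = true then σ e else !σ e) ≠ (if b' = true then σ e else !σ e) := by
    intro b b' hbb'
    cases b <;> cases b' <;> simp at hbb' ⊢
  exact key _ _ hne h2

/-- A red edge of a realisation at `h` enters a red arm. -/
lemma ShadowBase.red_arm_of_red_at_h {ω : Config κ} {e : E} {b : V} (hends : ends e = s(h, b))
    (he : shadowReal ends B Z k₀ σ ω e = true) : ∃ j, ω j = true ∧ b ∈ B j := by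
  obtain ⟨j, hbj⟩ := hb.h_edges e b hends
  refine ⟨j, ?_, hbj⟩
  rw [hb.shadowReal_apply_of_mem (ends_swap hends) hbj, hb.h_red e b hends] at he
  by_contra hj
  rw [if_neg hj] at he
  exact absurd he (by decide)

/-- A red edge of a realisation leaving a red arm `B j` ends at `h`. -/
lemma ShadowBase.end_of_red_of_mem_arm {ω : Config κ} {j : κ} (hj : ω j = true) {e : E}
    {a b : V} (hends : ends e = s(a, b)) (ha : a ∈ B j)
    (he : shadowReal ends B Z k₀ σ ω e = true) : b ∈ B j ∨ b = h := by
  rw [hb.shadowReal_apply_of_mem hends ha, if_pos hj] at he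
  by_cases hbh : b = h
  · exact Or.inr hbh
  by_cases hbB : ∃ j', b ∈ B j'
  · obtain ⟨j', hbj'⟩ := hbB
    have := hb.arm_eq_of_edge hends ha hbj'
    subst this
    exact Or.inl hbj'
  by_cases hbZ : b ∈ Z
  · exfalso
    have hjk : j = k₀ := by
      by_contra hne
      exact hb.no_BZ j hne e a b hends ha hbZ
    subst hjk
    rw [hb.kZ_blue e a b hends ha hbZ] at he
    exact absurd he (by decide)
  · exfalso
    have := hb.bdry_blue e a b hends (Or.inl (Or.inr ⟨j, ha⟩)) (by
      rintro ((h' | ⟨j', h'⟩) | h')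
      · exact hbh h'
      · exact hbB ⟨j', h'⟩
      · exact hbZ h')
    rw [this] at he
    exact absurd he (by decide)

/-- **`sRed ω` is closed under red adjacency.** -/
theorem ShadowBase.sRed_closed (ω : Config κ) :
    ∀ a ∈ sRed B h ω, ∀ b, (openGraph ends (shadowReal ends B Z k₀ σ ω)).Adj a b →
      b ∈ sRed B h ω := by
  intro a ha b hab
  obtain ⟨_, e, he, hends⟩ := openGraph_adj.1 hab
  rw [mem_sRed_iff] at ha ⊢
  rcases ha with rfl | ⟨j, hj, ha⟩
  · obtain ⟨j, hj, hbj⟩ := hb.red_arm_of_red_at_h hends he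
    exact Or.inr ⟨j, hj, hbj⟩
  · rcases hb.end_of_red_of_mem_arm hj hends ha he with hbj | hbh
    · exact Or.inr ⟨j, hj, hbj⟩
    · exact Or.inl hbh

/-- **The hull formula of the shadow cube**: the red cluster of `h` is `h` with the red arms. -/
theorem ShadowBase.cluster_shadowReal (ω : Config κ) :
    cluster ends (shadowReal ends B Z k₀ σ ω) h = sRed B h ω := by
  apply Set.Subset.antisymm
  · intro v hv
    exact mem_of_conn_of_closed (hb.sRed_closed ω) (by rw [mem_sRed_iff]; exact Or.inl rfl) hv
  · intro v hv
    rw [mem_sRed_iff] at hv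
    rcases hv with rfl | ⟨j, hj, hv⟩
    · exact mem_cluster_self _ _ _
    · exact cluster_mono (hb.insideConfig_le_shadowReal hj) h (hb.B_conn j v hv)

/-- `sRed` grows with the cube point. -/
lemma ShadowBase.sRed_mono {ω ω' : Config κ} (hω : ω ≤ ω') : sRed B h ω ⊆ sRed B h ω' := by
  intro x hx
  rw [mem_sRed_iff] at hx ⊢
  rcases hx with rfl | ⟨j, hj, hx⟩
  · exact Or.inl rfl
  · refine Or.inr ⟨j, ?_, hx⟩
    have := hω j
    rw [hj] at this
    cases h' : ω' j
    · rw [h'] at this; exact absurd this (by simp)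
    · rfl

end Base

end LocRows

end Summit.Ventures.PercRepro2
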